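import Summits.NavierStokesRegularity.NavierStokesRegularity.Theorems.ScenarioCensusRowF5lg
import Summits.NavierStokesRegularity.NavierStokesRegularity.Theorems.TypeIIInviscidRelaxationAxisymSwirlRegularSplitTightness
import HarnessLib

/-!
# The one-sided radial criterion is a statement about the germ at (axis × {T})

Helper toward the crux `AxisymSwirlRegular` (stmt-NavierStokesRegularity-1964, route TypeIIInviscidRelaxation),
criterion side of the registered line `radial_inflow_split` (stub `stub_oneSidedRadialCriterion` = route decl
`OneSidedRadialCriterion`, ⟨19059⟩).

Kernel certificate that the open content of ⟨19059⟩ only concerns the behaviour of the solution on arbitrarily thin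
axis tubes at times arbitrarily close to the final time: the gate `x₀u₀ + x₁u₁ = r u_r ≥ −Cν` asked on
`{cylRadius < δ} × [0,T)` may equivalently be asked on `{cylRadius < δ} × [T₁,T)` for SOME `δ > 0` and SOME `T₁ < T`
(the early times are free on a thinner tube by the sub-slab velocity bound, `|r u_r| ≤ r‖u‖`).

* `oneSidedRadialCriterionGeTwo_iff_germ` — `LogGate.OneSidedRadialCriterionGeTwo` (the `C ≥ 2` half, to which
  ⟨19059⟩ is kernel-reduced by `LogGate.oneSidedRadialCriterion_iff_geTwo`) ⟺ its germ form;
* `oneSidedRadialCriterion_iff_germ` — the route decl ⟨19059⟩ BY NAME ⟺ the germ form with `C ≥ 2`.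

Structural (does not use that either side is proved); nothing here closes ⟨19059⟩ or proves NavierStokesRegularity. [new]
-/

noncomputable section

set_option linter.dupNamespace false

open Set Filter Topology Real
open Literature.Analysis.FluidPDE

namespace Summit.NavierStokesRegularity.NavierStokesRegularity.Theorems.RadialInflowGerm

open Summit.NavierStokesRegularity.NavierStokesRegularity.Theorems
open Summit.NavierStokesRegularity.NavierStokesRegularity.Theorems.ScenarioCensus.LogGate

/-- **From a gate near the blow-up time to a gate from `t = 0`.** In the standing class (here only the sub-slab
velocity bound is used), a gate `r u_r ≥ −Cν` with `C > 0` on `{cylRadius < δ} × [T₁,T)` yields the gate on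
`{cylRadius < δ'} × [0,T)` for `δ' = min δ (Cν/(max B 0 + 1))`, `B` the velocity bound on `[0, max T₁ 0]`
(`x₀u₀ + x₁u₁ ≥ −r‖u‖`, `neg_cylRadius_mul_norm_le_radialMomentum`). [folklore] -/
theorem exists_gate_from_zero_of_gate_nearTop {ν T C δ T₁ : ℝ} (hν : 0 < ν) (hT : 0 < T) (hC : 0 < C)
    {u : ℝ → EuclideanSpace ℝ (Fin 3) → EuclideanSpace ℝ (Fin 3)}
    (hbd : ∀ T' < T, ∃ M : ℝ, ∀ t ∈ Icc 0 T', ∀ x, ‖u t x‖ ≤ M) (hδ : 0 < δ) (hT₁ : T₁ < T)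
    (hgate : ∀ t ∈ Ico 0 T, T₁ ≤ t → ∀ x : EuclideanSpace ℝ (Fin 3), cylRadius x < δ →
      -(C * ν) ≤ x 0 * u t x 0 + x 1 * u t x 1) :
    ∃ δ' : ℝ, 0 < δ' ∧ ∀ t ∈ Ico 0 T, ∀ x : EuclideanSpace ℝ (Fin 3), cylRadius x < δ' →
      -(C * ν) ≤ x 0 * u t x 0 + x 1 * u t x 1 := by
  set T₀ : ℝ := max T₁ 0 with hT₀_def
  have hT₀T : T₀ < T := max_lt hT₁ hT
  obtain ⟨B, hB⟩ := hbd T₀ hT₀T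
  set B' : ℝ := max B 0 + 1 with hB'_def
  have hB'0 : 0 < B' := by rw [hB'_def]; positivity
  have hBB' : B ≤ B' := by rw [hB'_def]; linarith [le_max_left B 0]
  refine ⟨min δ (C * ν / B'), lt_min hδ (div_pos (mul_pos hC hν) hB'0), fun t ht x hx => ?_⟩
  by_cases htT₀ : t < T₀
  · -- early times: `r u_r ≥ -r‖u‖ ≥ -δ' B ≥ -Cν`
    have hu : ‖u t x‖ ≤ B' := (hB t ⟨ht.1, htT₀.le⟩ x).trans hBB'
    have h1 := neg_cylRadius_mul_norm_le_radialMomentum x (u t x)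
    have hxB : cylRadius x < C * ν / B' := hx.trans_le (min_le_right _ _)
    have h2 : cylRadius x * ‖u t x‖ ≤ C * ν := by
      calc cylRadius x * ‖u t x‖ ≤ C * ν / B' * B' :=
            mul_le_mul hxB.le hu (norm_nonneg _) (div_pos (mul_pos hC hν) hB'0).le
        _ = C * ν := div_mul_cancel₀ _ hB'0.ne'
    linarith
  · push Not at htT₀
    exact hgate t ht ((le_max_left _ _).trans htT₀) x (hx.trans_le (min_le_left _ _))

/-- **The `C ≥ 2` half of ⟨19059⟩ is a germ statement at (axis × {T}).** `LogGate.OneSidedRadialCriterionGeTwo` is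
equivalent to the same implication with the gate `r u_r ≥ −Cν` (`C ≥ 2`) asked only on `{cylRadius < δ} × [T₁, T)`
for SOME `δ > 0` and SOME `T₁ < T`.  `→`: `exists_gate_from_zero_of_gate_nearTop`; `←`: take `T₁ = 0`. [new] -/
theorem oneSidedRadialCriterionGeTwo_iff_germ :
    OneSidedRadialCriterionGeTwo ↔
      ∀ (ν T : ℝ), 0 < ν → 0 < T →
        ∀ (u : ℝ → EuclideanSpace ℝ (Fin 3) → EuclideanSpace ℝ (Fin 3)) (p : ℝ → EuclideanSpace ℝ (Fin 3) → ℝ),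
        IsClassicalNSSolutionOn (Ico 0 T) ν 0 u p → IsLerayHopfOn T ν 0 (u 0) u →
        (∀ T' < T, ∃ M : ℝ, ∀ t ∈ Icc 0 T', ∀ x, ‖u t x‖ ≤ M) → (∀ t ∈ Ico 0 T, IsAxisymmetric (u t)) →
        HasRapidSpatialDecay (u 0) →
        (∃ C δ T₁ : ℝ, 2 ≤ C ∧ 0 < δ ∧ T₁ < T ∧ ∀ t ∈ Ico 0 T, T₁ ≤ t → ∀ x : EuclideanSpace ℝ (Fin 3),
          cylRadius x < δ → -(C * ν) ≤ x 0 * u t x 0 + x 1 * u t x 1) →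
        HasSmoothExtensionPast ν 0 u T := by
  constructor
  · rintro h ν T hν hT u p hcl hLH hbd hax hdec ⟨C, δ, T₁, hC, hδ, hT₁, hgate⟩
    obtain ⟨δ', hδ', hgate'⟩ :=
      exists_gate_from_zero_of_gate_nearTop hν hT (by linarith) hbd hδ hT₁ hgate
    exact h ν T hν hT u p hcl hLH hbd hax hdec ⟨C, δ', hC, hδ', hgate'⟩
  · rintro h ν T hν hT u p hcl hLH hbd hax hdec ⟨C, δ, hC, hδ, hgate⟩
    exact h ν T hν hT u p hcl hLH hbd hax hdec
      ⟨C, δ, 0, hC, hδ, hT, fun t ht _ x hx => hgate t ht x hx⟩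

/-- **⟨19059⟩ BY NAME is a germ statement at (axis × {T}):** the route decl `OneSidedRadialCriterion` is equivalent
to «in the standing class, a gate `r u_r ≥ −Cν` with `C ≥ 2` on SOME thin tube `{cylRadius < δ}` and from SOME time
`T₁ < T` on implies continuation past `T`» (`LogGate.oneSidedRadialCriterion_iff_geTwo` — the `C < 2` half is the
tree theorem `LogGate.oneSidedRadialCriterion_of_lt_two` — composed with `oneSidedRadialCriterionGeTwo_iff_germ`).
[new] -/
theorem oneSidedRadialCriterion_iff_germ :
    Summit.NavierStokesRegularity.NavierStokesRegularity.Theses.TypeIIInviscidRelaxation.OneSidedRadialCriterion ↔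
      ∀ (ν T : ℝ), 0 < ν → 0 < T →
        ∀ (u : ℝ → EuclideanSpace ℝ (Fin 3) → EuclideanSpace ℝ (Fin 3)) (p : ℝ → EuclideanSpace ℝ (Fin 3) → ℝ),
        IsClassicalNSSolutionOn (Ico 0 T) ν 0 u p → IsLerayHopfOn T ν 0 (u 0) u →
        (∀ T' < T, ∃ M : ℝ, ∀ t ∈ Icc 0 T', ∀ x, ‖u t x‖ ≤ M) → (∀ t ∈ Ico 0 T, IsAxisymmetric (u t)) →
        HasRapidSpatialDecay (u 0) →
        (∃ C δ T₁ : ℝ, 2 ≤ C ∧ 0 < δ ∧ T₁ < T ∧ ∀ t ∈ Ico 0 T, T₁ ≤ t → ∀ x : EuclideanSpace ℝ (Fin 3),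
          cylRadius x < δ → -(C * ν) ≤ x 0 * u t x 0 + x 1 * u t x 1) →
        HasSmoothExtensionPast ν 0 u T :=
  oneSidedRadialCriterion_iff_geTwo.trans oneSidedRadialCriterionGeTwo_iff_germ

/-! ## §2 Germ forms of the a-priori side ⟨19060⟩ and of the crux ⟨1964⟩ -/

/-- **⟨19060⟩ BY NAME is a germ statement at (axis × {T}).** The route decl `AprioriRadialInflowBound` (every
solution of the standing class has `r u_r ≥ −Cν` on some `{cylRadius < δ} × [0,T)`) is equivalent to the same with
the bound asked only on `{cylRadius < δ} × [T₁, T)` for SOME `T₁ < T`: the early times cost nothing because the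
constant is free (`r u_r ≥ −r‖u‖ ≥ −δB` on `[0, max T₁ 0]`, sub-slab bound). [new] -/
theorem aprioriRadialInflowBound_iff_germ :
    Summit.NavierStokesRegularity.NavierStokesRegularity.Theses.TypeIIInviscidRelaxation.AprioriRadialInflowBound ↔
      ∀ (ν T : ℝ), 0 < ν → 0 < T →
        ∀ (u : ℝ → EuclideanSpace ℝ (Fin 3) → EuclideanSpace ℝ (Fin 3)) (p : ℝ → EuclideanSpace ℝ (Fin 3) → ℝ),
        IsClassicalNSSolutionOn (Ico 0 T) ν 0 u p → IsLerayHopfOn T ν 0 (u 0) u →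
        (∀ T' < T, ∃ M : ℝ, ∀ t ∈ Icc 0 T', ∀ x, ‖u t x‖ ≤ M) → (∀ t ∈ Ico 0 T, IsAxisymmetric (u t)) →
        HasRapidSpatialDecay (u 0) →
        ∃ C δ T₁ : ℝ, 0 < δ ∧ T₁ < T ∧ ∀ t ∈ Ico 0 T, T₁ ≤ t → ∀ x : EuclideanSpace ℝ (Fin 3),
          cylRadius x < δ → -(C * ν) ≤ x 0 * u t x 0 + x 1 * u t x 1 := by
  constructor
  · intro h ν T hν hT u p hcl hLH hbd hax hdec
    obtain ⟨C, δ, hδ, hgate⟩ := h ν T hν hT u p hcl hLH hbd hax hdec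
    exact ⟨C, δ, 0, hδ, hT, fun t ht _ x hx => hgate t ht x hx⟩
  · intro h ν T hν hT u p hcl hLH hbd hax hdec
    obtain ⟨C, δ, T₁, hδ, hT₁, hgate⟩ := h ν T hν hT u p hcl hLH hbd hax hdec
    set T₀ : ℝ := max T₁ 0 with hT₀_def
    have hT₀T : T₀ < T := max_lt hT₁ hT
    obtain ⟨B, hB⟩ := hbd T₀ hT₀T
    set B' : ℝ := max B 0 with hB'_def
    refine ⟨max C (δ * B' / ν), δ, hδ, fun t ht x hx => ?_⟩
    by_cases htT₀ : t < T₀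
    · have hu : ‖u t x‖ ≤ B' := (hB t ⟨ht.1, htT₀.le⟩ x).trans (le_max_left _ _)
      have h1 := neg_cylRadius_mul_norm_le_radialMomentum x (u t x)
      have h2 : cylRadius x * ‖u t x‖ ≤ δ * B' :=
        mul_le_mul hx.le hu (norm_nonneg _) hδ.le
      have h3 : δ * B' ≤ max C (δ * B' / ν) * ν := by
        calc δ * B' = δ * B' / ν * ν := (div_mul_cancel₀ _ hν.ne').symm
          _ ≤ max C (δ * B' / ν) * ν := mul_le_mul_of_nonneg_right (le_max_right _ _) hν.le
      linarith
    · push Not at htT₀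
      have h1 := hgate t ht ((le_max_left _ _).trans htT₀) x hx
      have h3 : C * ν ≤ max C (δ * B' / ν) * ν := mul_le_mul_of_nonneg_right (le_max_left _ _) hν.le
      linarith

/-- **The crux ⟨1964⟩ BY NAME is a germ statement at (axis × {T}):** `AxisymSwirlRegular` holds iff every solution
of the standing axisymmetric class has SUBCRITICAL inflow `x₀u₀ + x₁u₁ = r u_r ≥ −ν` on SOME thin axis tube
`{cylRadius < δ}` from SOME time `T₁ < T` on (`axisymSwirlRegular_iff_aprioriRadialInflowBound_one` + the germ
upgrade `exists_gate_from_zero_of_gate_nearTop` at `C = 1`). [new] -/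
theorem axisymSwirlRegular_iff_aprioriGermBound_one :
    Summit.NavierStokesRegularity.NavierStokesRegularity.Theses.TypeIIInviscidRelaxation.AxisymSwirlRegular ↔
      ∀ (ν T : ℝ), 0 < ν → 0 < T →
        ∀ (u : ℝ → EuclideanSpace ℝ (Fin 3) → EuclideanSpace ℝ (Fin 3)) (p : ℝ → EuclideanSpace ℝ (Fin 3) → ℝ),
        IsClassicalNSSolutionOn (Ico 0 T) ν 0 u p → IsLerayHopfOn T ν 0 (u 0) u →
        (∀ T' < T, ∃ M : ℝ, ∀ t ∈ Icc 0 T', ∀ x, ‖u t x‖ ≤ M) → (∀ t ∈ Ico 0 T, IsAxisymmetric (u t)) →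
        HasRapidSpatialDecay (u 0) →
        ∃ δ T₁ : ℝ, 0 < δ ∧ T₁ < T ∧ ∀ t ∈ Ico 0 T, T₁ ≤ t → ∀ x : EuclideanSpace ℝ (Fin 3),
          cylRadius x < δ → -ν ≤ x 0 * u t x 0 + x 1 * u t x 1 := by
  rw [axisymSwirlRegular_iff_aprioriRadialInflowBound_one]
  constructor
  · intro h ν T hν hT u p hcl hLH hbd hax hdec
    obtain ⟨δ, hδ, hgate⟩ := h ν T hν hT u p hcl hLH hbd hax hdec
    exact ⟨δ, 0, hδ, hT, fun t ht _ x hx => hgate t ht x hx⟩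
  · intro h ν T hν hT u p hcl hLH hbd hax hdec
    obtain ⟨δ, T₁, hδ, hT₁, hgate⟩ := h ν T hν hT u p hcl hLH hbd hax hdec
    obtain ⟨δ', hδ', hgate'⟩ := exists_gate_from_zero_of_gate_nearTop (C := 1) hν hT one_pos hbd hδ hT₁
      (fun t ht htT₁ x hx => by simpa only [one_mul] using hgate t ht htT₁ x hx)
    exact ⟨δ', hδ', fun t ht x hx => by simpa only [one_mul] using hgate' t ht x hx⟩


end Summit.NavierStokesRegularity.NavierStokesRegularity.Theorems.RadialInflowGerm

end
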